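import Literature.AlgebraicGeometry.Motives.MumfordTateGroupDiagonal
import Literature.AlgebraicGeometry.Motives.HodgeLieDirectSum
import HarnessLib

/-!
# The Lie algebra of the Hodge group of `H^{⊕ι}` IS the diagonal: `Δ 𝔥(H) ⊆ 𝔥(H^{⊕ι})`, hence
# `dim_ℚ 𝔥(H^{⊕ι}) = dim_ℚ 𝔥(H)` and `𝔥(H^{⊕ι}) = Δ 𝔥(H)` (Moonen 1999 (1.8) / 2004 (4.10), Lie-algebra form)

Family `hodge`, layer `Literature/AlgebraicGeometry/Motives`; THEOREMS ONLY (no definition, no named fact; net debt 0).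
Written for the cell `pub-hodgecm2` (COR-CM), seat `b27` gen 42 (count-neutral Mumford–Tate-rank ladder): the missing
direction of `Motives/HodgeLieDirectSum` (gen 35), which proved only `dim 𝔥(H^{⊕ι}) ≤ dim 𝔥(H)`
(`finrank_hodgeLie_pi_const_le`: every `X ∈ 𝔥(⊕_ι H)` is block-scalar, `X = Δ(pr_j X in_j)`).  Here we prove that the
diagonal operator `Δ(Y) = Σ_i in_i ∘ Y ∘ pr_i` of EVERY `Y ∈ 𝔥(H)` lies in `𝔥(H^{⊕ι})`, so that the restriction
`𝔥(H^{⊕ι}) → 𝔥(H)`, `X ↦ pr_j X in_j`, is an isomorphism with inverse `Δ`.  This is the Lie-algebra form of Moonen's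
"`MT(V^{⊕n})` (`n ≥ 1`) is isomorphic to `MT(V)` acting diagonally on `V^{⊕n}`" [Moonen 1999 (1.8); Moonen 2004
Exercise (4.10)], whose GROUP form (on `K`-points of the tensor-stabiliser groups) is the tree's
`Motives/MumfordTateGroupDiagonal` (`hodgeGroupBaseChange_pi_const_eq`).  For a complex abelian variety this is
`Hg(Bⁿ) = Hg(B)`, used by the ladder as `dim MT(H¹(B^{m+1})) = dim MT(H¹B)` (`Motives/HodgeLieOfAbelianVarietyPower`).

MECHANISM (the infinitesimal version of `Motives/MumfordTateGroupDiagonal` §1/§3; pure multilinear algebra, no Zariski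
closure, no exponential).  For a decomposition `id_W = Σ_j in_j ∘ pr_j` (`in_j : W₁ → W`, `pr_j : W → W₁`) the identity of
`T^{a,b} W` expands as `Σ_{ε, δ} T(in ∘ ε, pr ∘ δ) ∘ T(pr ∘ ε, in ∘ δ)` with the family transport maps
`T(f, g) = (⊗_i f_i) ⊗ (⊗_j g_jᵀ)` (`sum_tensorSpaceMapOverFamily_eq_id`).  If `Y ∈ End W₁`, `X ∈ End W` are
INTERTWINED by the blocks (`in_j Y = X in_j`, `pr_j X = Y pr_j`), the derivation action `ρ(X) = D_a(X) ⊗ 1 − 1 ⊗ D_b(Xᵀ)`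
satisfies `ρ(X) ∘ T(in ε, pr δ) = T(in ε, pr δ) ∘ ρ(Y)` (§1, naturality of `ρ` along a FAMILY of intertwining maps —
`Motives/HodgeLieDirectSum` has the constant-family case); so `ρ(X) s = 0` as soon as `ρ(Y)` kills every component
`T(pr ε, in δ) s` (§2).  For Hodge structures and MORPHISMS `in_j`, `pr_j` the components of a Hodge tensor of `H` are Hodge
tensors of `H₁` of the same type (`tensorSpaceMapOverFamily_mem_hodgeClasses`), killed by `Y ∈ 𝔥(H₁)`; hence `X ∈ 𝔥(H)`
(§3 `mem_hodgeLie_of_blocks`, with the Mumford–Tate twin `mem_lieStabilizer_of_blocks`).  §4 applies this to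
`in_j = LinearMap.single`, `pr_j = LinearMap.proj` of the constant family.

* §1 `map_piTensorDerivation_of_forall_comp_eq`, `tensorSpaceMapOverFamily_tensorDerivation` — naturality of `D_a` and
  of `ρ_{a,b}` along families of intertwining maps.
* §2 `tensorDerivation_eq_zero_of_forall_blocks` — transfer of annihilation from the blocks to a block-scalar operator.
* §3 **`mem_hodgeLie_of_blocks`**, **`mem_lieStabilizer_of_blocks`**.
* §4 **`sum_single_comp_comp_proj_mem_hodgeLie_pi_const`** (`Δ(Y) ∈ 𝔥(H^{⊕ι})`), `…_mem_lieStabilizer_pi_const` (private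
  plumbing: `Δ(Y) v = (Y v_i)_i`, `pr_j Δ(Y) in_j = Y`, `in_j Y = Δ(Y) in_j`, `pr_j Δ(Y) = Y pr_j`),
  **`finrank_hodgeLie_le_pi_const`**, **`finrank_hodgeLie_pi_const_eq`** (`dim 𝔥(H^{⊕ι}) = dim 𝔥(H)`, `ι ≠ ∅`),
  **`eq_sum_single_comp_comp_proj_of_mem_hodgeLie_pi_const`** (`X = Δ(pr_j X in_j)` for `X ∈ 𝔥(H^{⊕ι})`).

## References

* [Moonen1999MTNotes] B. Moonen, *Notes on Mumford–Tate groups* (Centre Émile Borel, 1999), (1.8) («`MT(V^{⊕n})` (`n ≥ 1`)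
  is isomorphic to `MT(V)` acting diagonally on `V^{⊕n}`») and (1.13) («if `V₁ = V₂` then `Hg(V)` is the diagonal
  subgroup of `Hg(V₁) × Hg(V₂)`»). [cite: Moonen1999MTNotes, (1.8) and (1.13)]
* [Moonen2004MT] B. Moonen, *An introduction to Mumford–Tate groups* (2004), §4 Lemma 4.6 and Exercise 4.10.
  [cite: Moonen2004MT, §4 Exercise 4.10]
* [Deligne1982HodgeCycles] P. Deligne, *Hodge cycles on abelian varieties*, LNM 900 (1982), I §3.1 (the spaces `T^{a,b}`
  and the induced action) and Prop. 3.4 (the Hodge / Mumford–Tate group as the stabiliser of the Hodge tensors).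
  [cite: Deligne1982HodgeCycles, I §3.1 and Prop. 3.4]
* [MoonenZarhin1999LowDim] B. Moonen, Yu. Zarhin, *Hodge classes on abelian varieties of low dimension*, Math. Ann. 315
  (1999), §1 («For `n ≥ 1` we can identify `Hg(Xⁿ)` with `Hg(X)`, acting diagonally on `V_{Xⁿ} = (V_X)ⁿ`»)
  [corpus: paper:arxiv-math_9901113 p. 2] and §3 first paragraph. [cite: MoonenZarhin1999LowDim, §1 and §3]
* A. Borel, *Linear Algebraic Groups*, 2nd ed. (1991), §3.8–3.9 (the Lie algebra of a stabiliser is the annihilator).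
-/

noncomputable section

open scoped TensorProduct PiTensorProduct

namespace Literature.AlgebraicGeometry.Motives

/-! ### §1 Naturality of the derivation action along a family of intertwining maps -/

section LinearAlgebra

universe uK u₁ u₂

variable {K : Type uK} [Field K] {W₁ : Type u₁} [AddCommGroup W₁] [Module K W₁]
  {W : Type u₂} [AddCommGroup W] [Module K W]

/-- **Naturality of the Leibniz action on tensor powers along a FAMILY of intertwining maps**: if `f_i ∘ Y = X ∘ f_i`
for every `i`, then `(⊗_i f_i) ∘ D_a(Y) = D_a(X) ∘ (⊗_i f_i)` (checked on pure tensors; the constant-family case is the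
tree's `map_piTensorDerivation_of_comp_eq`). [cite: Deligne1982HodgeCycles, I §3.1] -/
theorem map_piTensorDerivation_of_forall_comp_eq {a : ℕ} (f : Fin a → (W₁ →ₗ[K] W)) {Y : Module.End K W₁}
    {X : Module.End K W} (h : ∀ i, f i ∘ₗ Y = X ∘ₗ f i) (x : ⨂[K]^a W₁) :
    PiTensorProduct.map f (piTensorDerivation a Y x) = piTensorDerivation a X (PiTensorProduct.map f x) := by
  induction x using PiTensorProduct.induction_on with
  | smul_tprod r v =>
    simp only [map_smul]
    rw [piTensorDerivation_tprod, PiTensorProduct.map_tprod, piTensorDerivation_tprod, map_sum]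
    congr 1
    refine Finset.sum_congr rfl fun k _ => ?_
    rw [PiTensorProduct.map_tprod]
    congr 1
    funext i
    rw [Function.apply_update (fun i => ⇑(f i)) v k (Y (v k)) i]
    have hfY : f k (Y (v k)) = X (f k (v k)) := by
      rw [← LinearMap.comp_apply, h k, LinearMap.comp_apply]
    simp only [hfY]
  | add x y hx hy => rw [map_add, map_add, hx, hy, map_add, map_add]

/-- **Naturality of `ρ_{a,b}` along the family transport `T(f, g) = (⊗_i f_i) ⊗ (⊗_j g_jᵀ)`**: if `f_i Y = X f_i` for all
`i` and `Y g_j = g_j X` for all `j`, then `T(f, g) (ρ(Y) t) = ρ(X) (T(f, g) t)` — the infinitesimal companion of the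
tree's `tensorSpaceMapOverFamily_tensorSpaceActOver`. [cite: Deligne1982HodgeCycles, I §3.1] -/
theorem tensorSpaceMapOverFamily_tensorDerivation {a b : ℕ} (f : Fin a → (W₁ →ₗ[K] W))
    (g : Fin b → (W →ₗ[K] W₁)) {Y : Module.End K W₁} {X : Module.End K W}
    (hf : ∀ i, f i ∘ₗ Y = X ∘ₗ f i) (hg : ∀ j, Y ∘ₗ g j = g j ∘ₗ X) (t : hodgeTensorSpaceOver K W₁ a b) :
    tensorSpaceMapOverFamily f g (tensorDerivation a b Y t) =
      tensorDerivation a b X (tensorSpaceMapOverFamily f g t) := by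
  have hg' : ∀ j, (g j).dualMap ∘ₗ (Y.dualMap : Module.End K (Module.Dual K W₁)) =
      (X.dualMap : Module.End K (Module.Dual K W)) ∘ₗ (g j).dualMap := fun j => by
    rw [LinearMap.dualMap_comp_dualMap, LinearMap.dualMap_comp_dualMap, hg j]
  induction t using TensorProduct.induction_on with
  | zero => rw [map_zero, map_zero, map_zero]
  | tmul x ξ =>
    simp only [tensorSpaceMapOverFamily]
    rw [tensorDerivation_apply, tensorDerivation_apply, LinearMap.sub_apply, LinearMap.rTensor_tmul,
      LinearMap.lTensor_tmul, map_sub, TensorProduct.map_tmul, TensorProduct.map_tmul, TensorProduct.map_tmul,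
      LinearMap.sub_apply, LinearMap.rTensor_tmul, LinearMap.lTensor_tmul,
      map_piTensorDerivation_of_forall_comp_eq f hf, map_piTensorDerivation_of_forall_comp_eq _ hg']
  | add x y hx hy => rw [map_add, map_add, hx, hy, map_add, map_add]

/-! ### §2 Transfer of annihilation from the blocks to a block-scalar operator -/

/-- **Transfer of annihilation from the blocks.**  Let `id_W = Σ_j in_j ∘ pr_j` (`in_j : W₁ → W`, `pr_j : W → W₁`), and let
`Y ∈ End W₁`, `X ∈ End W` be intertwined by the blocks: `in_j Y = X in_j`, `pr_j X = Y pr_j` for all `j`.  If `ρ(Y)`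
kills every component `T(pr ∘ ε, in ∘ δ) s ∈ T^{a,b}_K W₁` of `s ∈ T^{a,b}_K W`, then `ρ(X) s = 0`:
`ρ(X) s = Σ ρ(X) T(in ε, pr δ) T(pr ε, in δ) s = Σ T(in ε, pr δ) ρ(Y) T(pr ε, in δ) s = 0` — the infinitesimal form of
the tree's `tensorSpaceActOver_eq_self_of_forall_blocks` (Moonen's "`MT(Vⁿ) = MT(V)` […] through its diagonal action").
[cite: Moonen2004MT, §4 Exercise 4.10] [cite: Moonen1999MTNotes, (1.8)] [cite: Deligne1982HodgeCycles, I §3.1] -/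
theorem tensorDerivation_eq_zero_of_forall_blocks {J : Type*} [Fintype J]
    (inj : J → (W₁ →ₗ[K] W)) (pr : J → (W →ₗ[K] W₁))
    (hsum : ∑ j, inj j ∘ₗ pr j = LinearMap.id) {Y : Module.End K W₁} {X : Module.End K W}
    (hinj : ∀ j, inj j ∘ₗ Y = X ∘ₗ inj j) (hpr : ∀ j, pr j ∘ₗ X = Y ∘ₗ pr j) {a b : ℕ}
    {s : hodgeTensorSpaceOver K W a b}
    (hs : ∀ (ε : Fin a → J) (δ : Fin b → J),
      tensorDerivation a b Y (tensorSpaceMapOverFamily (fun i => pr (ε i)) (fun j => inj (δ j)) s) = 0) :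
    tensorDerivation a b X s = 0 := by
  have hexp := sum_tensorSpaceMapOverFamily_eq_id (fun j => inj j ∘ₗ pr j) hsum a b
  have hcomp : ∀ (ε : Fin a → J) (δ : Fin b → J),
      tensorSpaceMapOverFamily (fun i => inj (ε i) ∘ₗ pr (ε i)) (fun j => inj (δ j) ∘ₗ pr (δ j)) =
        tensorSpaceMapOverFamily (fun i => inj (ε i)) (fun j => pr (δ j)) ∘ₗ
          tensorSpaceMapOverFamily (a := a) (b := b) (fun i => pr (ε i)) (fun j => inj (δ j)) :=
    fun ε δ => (tensorSpaceMapOverFamily_comp _ _ _ _).symm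
  have hnat : ∀ (ε : Fin a → J) (δ : Fin b → J) (u : hodgeTensorSpaceOver K W₁ a b),
      tensorDerivation a b X (tensorSpaceMapOverFamily (fun i => inj (ε i)) (fun j => pr (δ j)) u) =
        tensorSpaceMapOverFamily (fun i => inj (ε i)) (fun j => pr (δ j)) (tensorDerivation a b Y u) :=
    fun ε δ u => (tensorSpaceMapOverFamily_tensorDerivation _ _ (fun i => hinj (ε i))
      (fun j => (hpr (δ j)).symm) u).symm
  have hs' : s = ∑ ε : Fin a → J, ∑ δ : Fin b → J,
      tensorSpaceMapOverFamily (fun i => inj (ε i)) (fun j => pr (δ j))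
        (tensorSpaceMapOverFamily (fun i => pr (ε i)) (fun j => inj (δ j)) s) := by
    have h := LinearMap.congr_fun hexp s
    simp only [LinearMap.sum_apply, LinearMap.id_apply, hcomp, LinearMap.comp_apply] at h
    exact h.symm
  rw [hs', map_sum]
  refine Finset.sum_eq_zero fun ε _ => ?_
  rw [map_sum]
  refine Finset.sum_eq_zero fun δ _ => ?_
  rw [hnat, hs, map_zero]

end LinearAlgebra

namespace HodgeStructure

/-! ### §3 Block-scalar operators with blocks in `𝔥(H₁)` lie in `𝔥(H)` -/

section Blocks

universe u

variable {V₁ : Type u} [AddCommGroup V₁] [Module ℚ V₁] [Module.Finite ℚ V₁]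
  {V : Type u} [AddCommGroup V] [Module ℚ V] [Module.Finite ℚ V] [HodgeTensorFacts.{u, u}] {n : ℤ}
  {H₁ : HodgeStructure V₁ n} {H : HodgeStructure V n} {J : Type} [Fintype J]

/-- **Transfer to a sum of copies, for the Lie algebra of the Hodge group.**  Let `in_j : H₁ → H`, `pr_j : H → H₁`
(`j ∈ J` finite) be morphisms of Hodge structures with `Σ_j in_j pr_j = id_V`; let `Y ∈ 𝔥(H₁)` and let `X ∈ End V` satisfy
`in_j Y = X in_j`, `pr_j X = Y pr_j` for all `j`.  Then `X ∈ 𝔥(H)`: every Hodge tensor `s` of `H` of type `(p,p)` has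
components `T(pr ε, in δ) s` that are Hodge tensors of `H₁` of type `(p,p)` (`tensorSpaceMapOverFamily_mem_hodgeClasses`),
killed by `ρ(Y)`, and `ρ(X) s` is recovered from them (`tensorDerivation_eq_zero_of_forall_blocks`).  Lie-algebra form of
the tree's `mem_hodgeGroup_of_blocks`. [cite: Moonen1999MTNotes, (1.8) and (1.13)] [cite: Moonen2004MT, §4 Exercise 4.10]
[cite: Deligne1982HodgeCycles, I §3.1 and Prop. 3.4] -/
theorem mem_hodgeLie_of_blocks (inj : J → Hom H₁ H) (pr : J → Hom H H₁)
    (hsum : ∑ j, (inj j).toLinearMap ∘ₗ (pr j).toLinearMap = LinearMap.id)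
    {Y : Module.End ℚ V₁} (hY : Y ∈ H₁.hodgeLie) {X : Module.End ℚ V}
    (hinj : ∀ j, (inj j).toLinearMap ∘ₗ Y = X ∘ₗ (inj j).toLinearMap)
    (hpr : ∀ j, (pr j).toLinearMap ∘ₗ X = Y ∘ₗ (pr j).toLinearMap) :
    X ∈ H.hodgeLie := by
  rw [mem_hodgeLie_iff]
  intro a b p hab s hs
  refine tensorDerivation_eq_zero_of_forall_blocks (fun j => (inj j).toLinearMap) (fun j => (pr j).toLinearMap)
    hsum hinj hpr fun ε δ => ?_
  exact (mem_hodgeLie_iff H₁ Y).1 hY a b p hab _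
    (tensorSpaceMapOverFamily_mem_hodgeClasses (fun i => pr (ε i)) (fun j => inj (δ j)) hs)

/-- **The Mumford–Tate twin**: with the same block hypotheses and `Y ∈ 𝔪𝔱(H₁)` (the annihilator of the weight-`0` Hodge
tensors of type `(0,0)`, `lieStabilizer`), `X ∈ 𝔪𝔱(H)` — Lie-algebra form of the tree's `mem_mumfordTateGroup_of_blocks`
(Moonen's (4.10) "`MT(Vⁿ) = MT(V)` […] through its diagonal action"). [cite: Moonen2004MT, §4 Exercise 4.10]
[cite: Moonen1999MTNotes, (1.8)] [cite: Deligne1982HodgeCycles, I Prop. 3.4] -/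
theorem mem_lieStabilizer_of_blocks (inj : J → Hom H₁ H) (pr : J → Hom H H₁)
    (hsum : ∑ j, (inj j).toLinearMap ∘ₗ (pr j).toLinearMap = LinearMap.id)
    {Y : Module.End ℚ V₁} (hY : Y ∈ H₁.lieStabilizer) {X : Module.End ℚ V}
    (hinj : ∀ j, (inj j).toLinearMap ∘ₗ Y = X ∘ₗ (inj j).toLinearMap)
    (hpr : ∀ j, (pr j).toLinearMap ∘ₗ X = Y ∘ₗ (pr j).toLinearMap) :
    X ∈ H.lieStabilizer := by
  rw [mem_lieStabilizer_iff]
  intro a b hab s hs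
  refine tensorDerivation_eq_zero_of_forall_blocks (fun j => (inj j).toLinearMap) (fun j => (pr j).toLinearMap)
    hsum hinj hpr fun ε δ => ?_
  exact (mem_lieStabilizer_iff H₁ Y).1 hY a b hab _
    (tensorSpaceMapOverFamily_mem_hodgeClasses (fun i => pr (ε i)) (fun j => inj (δ j)) hs)

end Blocks

/-! ### §4 The diagonal of `H^{⊕ι}`: `Δ 𝔥(H) ⊆ 𝔥(H^{⊕ι})`, `dim 𝔥(H^{⊕ι}) = dim 𝔥(H)`, `𝔥(H^{⊕ι}) = Δ 𝔥(H)` -/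

section PiConst

universe u

variable {ι : Type} [Fintype ι] [DecidableEq ι] {V : Type u} [AddCommGroup V] [Module ℚ V] [Module.Finite ℚ V]
  [HodgeTensorFacts.{u, u}] {n : ℤ} (H : HodgeStructure V n)

omit [Module.Finite ℚ V] [HodgeTensorFacts.{u, u}] in
/-- The diagonal operator `Δ(Y) = Σ_i in_i ∘ Y ∘ pr_i` of `V^{⊕ι}` acts coordinatewise: `Δ(Y) v = (Y v_i)_i`. [folklore] -/
private theorem sum_single_comp_comp_proj_apply (Y : Module.End ℚ V) (v : ι → V) :
    (∑ i, LinearMap.single ℚ (fun _ : ι => V) i ∘ₗ Y ∘ₗ LinearMap.proj i) v = fun i => Y (v i) := by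
  simp only [LinearMap.sum_apply, LinearMap.comp_apply, LinearMap.coe_single, LinearMap.proj_apply]
  exact Finset.univ_sum_single _

omit [Module.Finite ℚ V] [HodgeTensorFacts.{u, u}] in
/-- The diagonal blocks of the diagonal operator: `pr_j ∘ Δ(Y) ∘ in_j = Y`. [folklore] -/
private theorem proj_comp_sum_single_comp_comp_proj_comp_single (Y : Module.End ℚ V) (j : ι) :
    LinearMap.proj j ∘ₗ (∑ i, LinearMap.single ℚ (fun _ : ι => V) i ∘ₗ Y ∘ₗ LinearMap.proj i) ∘ₗ
      LinearMap.single ℚ (fun _ : ι => V) j = Y := by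
  refine LinearMap.ext fun v => ?_
  rw [LinearMap.comp_apply, LinearMap.comp_apply, sum_single_comp_comp_proj_apply]
  simp only [LinearMap.proj_apply, LinearMap.coe_single, Pi.single_eq_same]

omit [Module.Finite ℚ V] [HodgeTensorFacts.{u, u}] in
/-- `Δ(Y)` is intertwined with `Y` by the coordinate inclusions: `in_j ∘ Y = Δ(Y) ∘ in_j`. [folklore] -/
private theorem single_comp_eq_sum_single_comp_comp_proj_comp_single (Y : Module.End ℚ V) (j : ι) :
    LinearMap.single ℚ (fun _ : ι => V) j ∘ₗ Y =
      (∑ i, LinearMap.single ℚ (fun _ : ι => V) i ∘ₗ Y ∘ₗ LinearMap.proj i) ∘ₗ LinearMap.single ℚ (fun _ : ι => V) j := by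
  refine LinearMap.ext fun v => funext fun i => ?_
  rw [LinearMap.comp_apply, LinearMap.comp_apply, sum_single_comp_comp_proj_apply]
  simp only [LinearMap.coe_single]
  exact (Pi.apply_single (fun _ : ι => (Y : V → V)) (fun _ => map_zero Y) j v i).symm

omit [Module.Finite ℚ V] [HodgeTensorFacts.{u, u}] in
/-- `Δ(Y)` is intertwined with `Y` by the coordinate projections: `pr_j ∘ Δ(Y) = Y ∘ pr_j`. [folklore] -/
private theorem proj_comp_sum_single_comp_comp_proj (Y : Module.End ℚ V) (j : ι) :
    LinearMap.proj j ∘ₗ (∑ i, LinearMap.single ℚ (fun _ : ι => V) i ∘ₗ Y ∘ₗ LinearMap.proj i) =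
      Y ∘ₗ (LinearMap.proj j : (ι → V) →ₗ[ℚ] V) := by
  refine LinearMap.ext fun v => ?_
  rw [LinearMap.comp_apply, LinearMap.comp_apply, sum_single_comp_comp_proj_apply]
  simp only [LinearMap.proj_apply]

/-- **`Δ(Y) ∈ 𝔥(H^{⊕ι})` for `Y ∈ 𝔥(H)`** — the reverse inclusion of Moonen's (1.8) / (4.10) "`Hg(V^{⊕n})` is `Hg(V)`
acting diagonally", for the Lie algebra of the Hodge group of the constant family `⊕_ι H` (`HodgeStructure.pi`):
§3 for the morphisms `in_j = Hom.piSingle`, `pr_j = Hom.piProj` (`Σ_j in_j pr_j = id`, `sum_piSingle_comp_piProj`).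
[cite: Moonen1999MTNotes, (1.8) and (1.13)] [cite: Moonen2004MT, §4 Exercise 4.10] [cite: MoonenZarhin1999LowDim, §1 and §3] -/
theorem sum_single_comp_comp_proj_mem_hodgeLie_pi_const {Y : Module.End ℚ V} (hY : Y ∈ H.hodgeLie) :
    (∑ i, LinearMap.single ℚ (fun _ : ι => V) i ∘ₗ Y ∘ₗ LinearMap.proj i) ∈ (pi fun _ : ι => H).hodgeLie := by
  refine mem_hodgeLie_of_blocks (Hom.piSingle fun _ : ι => H) (Hom.piProj fun _ : ι => H) sum_piSingle_comp_piProj hY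
    (fun j => ?_) (fun j => ?_)
  · rw [Hom.piSingle_toLinearMap]
    exact single_comp_eq_sum_single_comp_comp_proj_comp_single Y j
  · rw [Hom.piProj_toLinearMap]
    exact proj_comp_sum_single_comp_comp_proj Y j

/-- **The Mumford–Tate twin: `Δ(Y) ∈ 𝔪𝔱(H^{⊕ι})` for `Y ∈ 𝔪𝔱(H)`** (`lieStabilizer`). [cite: Moonen2004MT, §4 Exercise 4.10]
[cite: Moonen1999MTNotes, (1.8)] -/
theorem sum_single_comp_comp_proj_mem_lieStabilizer_pi_const {Y : Module.End ℚ V} (hY : Y ∈ H.lieStabilizer) :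
    (∑ i, LinearMap.single ℚ (fun _ : ι => V) i ∘ₗ Y ∘ₗ LinearMap.proj i) ∈ (pi fun _ : ι => H).lieStabilizer := by
  refine mem_lieStabilizer_of_blocks (Hom.piSingle fun _ : ι => H) (Hom.piProj fun _ : ι => H) sum_piSingle_comp_piProj
    hY (fun j => ?_) (fun j => ?_)
  · rw [Hom.piSingle_toLinearMap]
    exact single_comp_eq_sum_single_comp_comp_proj_comp_single Y j
  · rw [Hom.piProj_toLinearMap]
    exact proj_comp_sum_single_comp_comp_proj Y j

/-- **`dim_ℚ 𝔥(H) ≤ dim_ℚ 𝔥(H^{⊕ι})` for nonempty `ι`**: the diagonal `Y ↦ Δ(Y) : 𝔥(H) → 𝔥(H^{⊕ι})` is an injective linear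
map (`pr_j Δ(Y) in_j = Y`). [cite: Moonen1999MTNotes, (1.8)] [cite: MoonenZarhin1999LowDim, §1 and §3] -/
theorem finrank_hodgeLie_le_pi_const [Nonempty ι] :
    Module.finrank ℚ H.hodgeLie ≤ Module.finrank ℚ (pi fun _ : ι => H).hodgeLie := by
  classical
  obtain ⟨j₀⟩ := ‹Nonempty ι›
  let Δ : H.hodgeLie →ₗ[ℚ] (pi fun _ : ι => H).hodgeLie :=
    { toFun := fun Y => ⟨∑ i, LinearMap.single ℚ (fun _ : ι => V) i ∘ₗ (Y : Module.End ℚ V) ∘ₗ LinearMap.proj i,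
        sum_single_comp_comp_proj_mem_hodgeLie_pi_const H Y.2⟩
      map_add' := fun Y Z => Subtype.ext (by
        simp only [Submodule.coe_add, LinearMap.comp_add, LinearMap.add_comp, Finset.sum_add_distrib])
      map_smul' := fun c Y => Subtype.ext (by
        simp only [Submodule.coe_smul, LinearMap.comp_smul, LinearMap.smul_comp, RingHom.id_apply,
          Finset.smul_sum]) }
  have hΔ : Function.Injective Δ := fun Y Z hYZ => by
    have h : (∑ i, LinearMap.single ℚ (fun _ : ι => V) i ∘ₗ (Y : Module.End ℚ V) ∘ₗ LinearMap.proj i) =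
        ∑ i, LinearMap.single ℚ (fun _ : ι => V) i ∘ₗ (Z : Module.End ℚ V) ∘ₗ LinearMap.proj i :=
      congrArg (fun X : (pi fun _ : ι => H).hodgeLie => (X : Module.End ℚ (ι → V))) hYZ
    refine Subtype.ext ?_
    rw [← proj_comp_sum_single_comp_comp_proj_comp_single (Y : Module.End ℚ V) j₀,
      ← proj_comp_sum_single_comp_comp_proj_comp_single (Z : Module.End ℚ V) j₀, h]
  exact LinearMap.finrank_le_finrank_of_injective hΔ

/-- **Moonen's (1.8) / (4.10) for the Lie algebra of the Hodge group, as an equality of dimensions: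
`dim_ℚ 𝔥(H^{⊕ι}) = dim_ℚ 𝔥(H)`** for `ι` finite nonempty (`≤`: the tree's `finrank_hodgeLie_pi_const_le`; `≥`: the
diagonal).  For a complex abelian variety: `dim Hg(Bⁿ) = dim Hg(B)`. [cite: Moonen1999MTNotes, (1.8) and (1.13)]
[cite: Moonen2004MT, §4 Exercise 4.10] [cite: MoonenZarhin1999LowDim, §1 and §3] -/
theorem finrank_hodgeLie_pi_const_eq [Nonempty ι] :
    Module.finrank ℚ (pi fun _ : ι => H).hodgeLie = Module.finrank ℚ H.hodgeLie :=
  le_antisymm (finrank_hodgeLie_pi_const_le H) (finrank_hodgeLie_le_pi_const H)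

/-- **`𝔥(H^{⊕ι}) = Δ 𝔥(H)`: every `X ∈ 𝔥(⊕_ι H)` is the diagonal operator of its block, `X = Δ(pr_j X in_j)`** (all
diagonal blocks of `X` coincide and the off-diagonal ones vanish, `Motives/HodgeLieDirectSum`; and `Δ(pr_j X in_j)` lies in
`𝔥(H^{⊕ι})` with the same blocks). [cite: Moonen1999MTNotes, (1.8) and (1.13)] [cite: Deligne1982HodgeCycles, I Prop. 3.4] -/
theorem eq_sum_single_comp_comp_proj_of_mem_hodgeLie_pi_const {X : Module.End ℚ (ι → V)}
    (hX : X ∈ (pi fun _ : ι => H).hodgeLie) (j : ι) :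
    X = ∑ i, LinearMap.single ℚ (fun _ : ι => V) i ∘ₗ
      (LinearMap.proj j ∘ₗ X ∘ₗ LinearMap.single ℚ (fun _ : ι => V) j) ∘ₗ LinearMap.proj i := by
  set Y := LinearMap.proj j ∘ₗ X ∘ₗ LinearMap.single ℚ (fun _ : ι => V) j with hY
  have hYmem : Y ∈ H.hodgeLie := proj_comp_single_mem_hodgeLie_pi (fun _ : ι => H) j hX
  have hD : (∑ i, LinearMap.single ℚ (fun _ : ι => V) i ∘ₗ Y ∘ₗ LinearMap.proj i) ∈ (pi fun _ : ι => H).hodgeLie :=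
    sum_single_comp_comp_proj_mem_hodgeLie_pi_const H hYmem
  have hdiff : X - (∑ i, LinearMap.single ℚ (fun _ : ι => V) i ∘ₗ Y ∘ₗ LinearMap.proj i) ∈
      (pi fun _ : ι => H).hodgeLie := Submodule.sub_mem _ hX hD
  have h0 := eq_zero_of_forall_proj_comp_single_eq_zero (fun _ : ι => H) hdiff fun i => by
    rw [LinearMap.sub_comp, LinearMap.comp_sub, proj_comp_sum_single_comp_comp_proj_comp_single,
      proj_comp_single_eq_of_mem_hodgeLie_pi_const H hX i j, ← hY, sub_self]
  exact sub_eq_zero.1 h0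

/-- **`𝔥(H^{⊕ι})` is the image of `𝔥(H)` under the diagonal** (as sets of endomorphisms of `V^{⊕ι}`), for nonempty `ι`.
[cite: Moonen1999MTNotes, (1.8) and (1.13)] [cite: Moonen2004MT, §4 Exercise 4.10] -/
theorem hodgeLie_pi_const_eq_image_diagonal [Nonempty ι] :
    ((pi fun _ : ι => H).hodgeLie : Set (Module.End ℚ (ι → V))) =
      (fun Y : Module.End ℚ V => ∑ i, LinearMap.single ℚ (fun _ : ι => V) i ∘ₗ Y ∘ₗ LinearMap.proj i) ''
        (H.hodgeLie : Set (Module.End ℚ V)) := by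
  obtain ⟨j₀⟩ := ‹Nonempty ι›
  refine Set.Subset.antisymm (fun X hX => ?_) ?_
  · exact ⟨_, proj_comp_single_mem_hodgeLie_pi (fun _ : ι => H) j₀ hX,
      (eq_sum_single_comp_comp_proj_of_mem_hodgeLie_pi_const H hX j₀).symm⟩
  · rintro _ ⟨Y, hY, rfl⟩
    exact sum_single_comp_comp_proj_mem_hodgeLie_pi_const H hY

end PiConst

end HodgeStructure

end Literature.AlgebraicGeometry.Motives

end
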